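import Summits.Langlands.Statement
import Literature.NumberTheory.GaloisRepresentations.DecompositionGroupOfCompletion
import Literature.NumberTheory.GaloisRepresentations.HeckeCharacterGaloisAvatarProofs
import Literature.NumberTheory.Automorphic.ReciprocityGLnRankOneProofs
import Literature.NumberTheory.Automorphic.AutomorphicRepsGLSatakeFlathProofs
import HarnessLib

/-!
# `ReciprocityUpToIrreducibility` (item stmt-Langlands-14328), line `Sketch`, stub W
# (`stub_weakExistence`): what the tree proves of weak existence today

Support file (nothing here closes the item).  Stub W of the line is the datum-free core of
direction (A) of reciprocity for `GL_n` — Buzzard–Gee 2014, Conj. 3.2.2 in its weakest form: every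
L-algebraic cuspidal `π` of `GL_n(𝔸_K)` has, for all `ℓ`, `ι`, SOME `ρ : Γ_K → GL_n(ℚ̄_ℓ)`,
unramified almost everywhere, de Rham at every `v ∣ ℓ` for Fontaine's PINNED datum
(`Literature.NumberTheory.PAdicHodge.fontainePstAdicCompletion v ℓ hv`), and Satake–Frobenius
compatible with `(π, ι)` at almost all places.  It is an OPEN PROBLEM (all `n`, all number fields,
all L-algebraic `π`).  This file records, sorry-free, on the standard axioms, and WITHOUT importing
the route's Theses file (cycle hazard (e) of the route docstring: it imports
`Summits.Langlands.Statement` and Literature only):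

* `isLocallyUnramified_toLocal_of_isUnramifiedAt`,
  `isDeRhamFramed_fontainePstAdicCompletion_of_isUnramifiedAt` — **the pinned de Rham clause is
  dischargeable today exactly in the unramified case**: if `ρ` is unramified at a place `v ∣ ℓ`
  (every inertia group above `v` acts trivially) then `ρ|_{Γ_{K_v}}` kills the local inertia group
  (`I_{𝔓₀} = res (I_{K_v})`, Neukirch II (9.6), tree `inertia_adicCompletionPrime_eq_map_absInertia`)
  and is therefore de Rham for EVERY `p`-adic Hodge datum, in particular the pinned one (structure
  field `isDeRhamWith_of_isLocallyUnramified`: unramified ⇒ crystalline ⇒ de Rham, Fontaine 1994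
  Exp. III §5).  Any rank `n`; reusable by the other stubs of the line.
* `weakExistence_of_langlands` — **the summit implies stub W verbatim** (so W is not refutable
  unless `Langlands` is): direction (A) of the summit gives an irreducible geometric corresponding
  `ρ`; `IsGeometricFramed Rec ρ` is by definition the pinned clause (`ReciprocityData.pst` ignores
  `Rec`) and the first conjunct of `Corresponds` is Satake–Frobenius compatibility a.e.
* `weakExistence_rankOne_of_isFiniteOrder` — **the one sector of W provable today with the
  pinned de Rham clause**: `n = 1`, `π` with Hecke character `χ_π` of finite order and unramified
  above `ℓ`.  Then the `ℓ`-adic avatar `r` of the Artin character of `χ_π` (class field theory,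
  proved in the tree: `HeckeCharacter.exists_lAdic_of_isFiniteOrder`) is unramified exactly where
  `χ_π` is — in particular above `ℓ`, whence de Rham there by the first bullet — and
  `char(Frob_v) = X - ι⁻¹(χ_π(ϖ_v))⁻¹ = arithFrobPolyOfSatake ι q_v 1 {χ_π(ϖ_v)}` at every place
  where `π` is unramified (all but finitely many: Flath, `hasSatakeParamAt_cofinite_holds`; the
  `GL₁` dictionary `isUnramifiedAt_heckeCharacter_glOne`,
  `exists_eq_singleton_of_hasSatakeParamAt_glOne`).

What is NOT provable in the present tree, and why (the blocker map of the stub):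
* `n = 1`, `χ_π` of infinite order or ramified above `ℓ` (e.g. `π = ‖·‖`, whose avatar is the
  cyclotomic character): Weil's theorem `HeckeCharacter.IsAlgebraic.exists_lAdic` has no clause at
  `v ∣ ℓ`, and de Rham-ness of a representation RAMIFIED at `v ∣ ℓ` for the pinned datum is
  independent of the tree without the named fact `FontaineDatumExists` (the pin is Hilbert's `ε`
  over `IsFontaineDatum`; the truncated model, for which de Rham ⇔ unramified, inhabits the type)
  and, even granting it, Fontaine's clauses (F1)–(F7) assert de Rham-ness only of unramified
  representations and of the cyclotomic character (no twist/tensor/Lubin–Tate clause: "locally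
  algebraic abelian ⇒ de Rham" is not in the tree).
* `n ≥ 2`, `K` totally real or CM, `π` regular: the named fact
  `Literature.NumberTheory.Automorphic.exists_galoisRep_of_regularAlgebraic` (lang.S27, HLTT Thm. A
  + Scholze Cor. V.4.2 + Varma; no `_holds`; = route item `GaloisRepOfRegularAlgebraic`) gives the
  Satake half in C-normalisation (`arithFrobPolyOfSatake ι q_v n α` for the C-algebraic twist
  `π ⊗ |det|^{(1-n)/2}`), but NO de Rham clause at `v ∣ ℓ`; no Literature fact mentions the pinned
  datum at all.
* `π` non-regular, or `K` neither totally real nor CM: no Galois representation is known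
  (`Literature.Barriers.Langlands.NonRegularWeightBarrier`, `ShimuraVarietyRealizationBarrier`);
  the registered conjecture items covering these sectors are `AutToGalCM` (stmt-Langlands-1059,
  CM fields, all L-algebraic `π`) and `DirARegularCM` (stmt-Langlands-2379), both open.

References: K. Buzzard, T. Gee, *The conjectural connections between automorphic representations
and Galois representations* (2014), Conj. 3.2.1–3.2.2 [BuzzardGeeLMS2014]; J.-M. Fontaine,
Astérisque 223 (1994), Exp. III §5 [FontaineAsterisque223III]; J. Neukirch, *Algebraic Number
Theory* (1999), Ch. II (9.6) [NeukirchANT1999]; J. Tate, in Cassels–Fröhlich (1967), Ch. VII §5.1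
[CasselsFrohlichANT1967]; J.-P. Serre, *Abelian ℓ-adic representations* (1968), Ch. III §2.3
[SerreAbelianLadic1968]; D. Flath, Corvallis (1979), Thm. 3 [Flath1979].
No new definitions; axioms `propext`, `Classical.choice`, `Quot.sound`.
-/

noncomputable section

set_option linter.dupNamespace false -- project-wide option (lakefile weak.linter.dupNamespace); `Summit.Langlands.Langlands` is the mandated namespace

open scoped NumberField Classical Polynomial
open Filter IsDedekindDomain Polynomial Field
open Literature.NumberTheory.Automorphic Literature.NumberTheory.GaloisRepresentations
open Summit.Langlands

namespace Summit.Langlands.Langlands.Theorems.ReciprocityUpToIrreducibility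

variable {K : Type} [Field K] [NumberField K] {ℓ : ℕ} [Fact ℓ.Prime]

/-! ### §1. The pinned de Rham clause in the unramified case (any rank) -/

/-- **Unramified at `v` ⇒ the local restriction kills the local inertia group.**  If every inertia
group `I_𝔓 ≤ Γ_K`, `𝔓 ∣ v`, acts trivially through `ρ` (`FramedGaloisRep.IsUnramifiedAt`), then
`ρ|_{Γ_{K_v}} = ρ ∘ res` (`FramedGaloisRep.toLocal`) is trivial on `I_{K_v} = absInertia K_v`
(`FramedRep.IsLocallyUnramified`), because `res (I_{K_v}) = I_{𝔓₀}` for the prime `𝔓₀ ∣ v` cut out by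
the chosen embedding `K̄ → K̄_v` (Neukirch, Ch. II Prop. (9.6); tree
`inertia_adicCompletionPrime_eq_map_absInertia`, `adicCompletionPrime_mem_primesAbove`).
[cite: NeukirchANT1999, Ch. II §9 Prop. (9.6)] -/
theorem isLocallyUnramified_toLocal_of_isUnramifiedAt {n : ℕ}
    (ρ : FramedGaloisRep K (PadicAlgCl ℓ) n) (v : HeightOneSpectrum (𝓞 K))
    (h : ρ.IsUnramifiedAt v) : (ρ.toLocal v).IsLocallyUnramified := by
  intro σ hσ
  rw [FramedGaloisRep.toLocal_apply]
  refine h _ (adicCompletionPrime_mem_primesAbove K v) _ ?_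
  rw [inertia_adicCompletionPrime_eq_map_absInertia K v]
  exact Subgroup.mem_map_of_mem _ hσ

/-- **Unramified at a place `v ∣ ℓ` ⇒ de Rham at `v` for Fontaine's pinned datum.**  A
representation unramified at `v ∣ ℓ` restricts to a locally unramified representation of `Γ_{K_v}`
(`isLocallyUnramified_toLocal_of_isUnramifiedAt`), and unramified representations are de Rham for
every `p`-adic Hodge datum (structure field `isDeRhamWith_of_isLocallyUnramified` of
`PstWeilDeligneData`: unramified ⇒ crystalline ⇒ de Rham, Fontaine 1994, Exp. III §5), in
particular for `fontainePstAdicCompletion v ℓ hv` — with no appeal to `FontaineDatumExists`.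
[cite: FontaineAsterisque223III, Exp. III §5] -/
theorem isDeRhamFramed_fontainePstAdicCompletion_of_isUnramifiedAt {n : ℕ}
    (ρ : FramedGaloisRep K (PadicAlgCl ℓ) n) (v : HeightOneSpectrum (𝓞 K))
    (hv : ((ℓ : ℕ) : 𝓞 K) ∈ v.asIdeal) (h : ρ.IsUnramifiedAt v) :
    (Literature.NumberTheory.PAdicHodge.fontainePstAdicCompletion v ℓ hv).IsDeRhamFramed
      (ρ.toLocal v) :=
  PstWeilDeligneData.isDeRhamFramed_of_isLocallyUnramified _
    (isLocallyUnramified_toLocal_of_isUnramifiedAt ρ v h)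

/-- **Everywhere-unramified representations are pinned-geometric**: unramified at every finite
place ⇒ unramified almost everywhere and de Rham at every `v ∣ ℓ` for the pinned datum (the
conjunction `IsGeometricFramed Rec ρ` of the summit, for every `Rec`). [folklore] -/
theorem isGeometricFramed_of_forall_isUnramifiedAt (Rec : ReciprocityData K) {n : ℕ}
    (ρ : FramedGaloisRep K (PadicAlgCl ℓ) n)
    (h : ∀ v : HeightOneSpectrum (𝓞 K), ρ.IsUnramifiedAt v) : IsGeometricFramed Rec ρ :=
  ⟨Filter.Eventually.of_forall h,
    fun v hv => isDeRhamFramed_fontainePstAdicCompletion_of_isUnramifiedAt ρ v hv (h v)⟩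

/-! ### §2. The summit implies stub W verbatim -/

/-- **`Langlands` ⇒ weak existence (stub W of line `Sketch`, verbatim).**  Direction (A) of the
summit attaches to every L-algebraic cuspidal `π` of `GL_n(𝔸_K)` (`n ≥ 1`) and every `ℓ`, `ι` an
irreducible `ρ` with `IsGeometricFramed Rec ρ` — which is, by definition of the pinned datum
`ReciprocityData.pst`, the clause "unramified a.e. and de Rham at every `v ∣ ℓ` for
`fontainePstAdicCompletion`" — and `Corresponds Rec ι π ρ`, whose first conjunct is Satake–Frobenius
compatibility at almost all places.  Hence W is a consequence of the summit (Buzzard–Gee 2014,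
Conj. 3.2.2 ⇒ its weak form) and cannot be refuted unless the summit is.
[cite: BuzzardGeeLMS2014, Conj. 3.2.1 and Conj. 3.2.2] -/
theorem weakExistence_of_langlands (h : _root_.Langlands) :
    ∀ (K : Type) [Field K] [NumberField K] (n : ℕ) (hcpt : isCompact_glFiniteIntegralLevel n K),
      0 < n → ∀ π : CuspidalAutomorphicRepData n K hcpt, π.1.IsLAlgebraic →
        ∀ (ℓ : ℕ) [Fact ℓ.Prime] (ι : PadicAlgCl ℓ ≃+* ℂ),
          ∃ ρ : FramedGaloisRep K (PadicAlgCl ℓ) n,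
            ((∀ᶠ v : HeightOneSpectrum (𝓞 K) in cofinite, ρ.IsUnramifiedAt v) ∧
              ∀ (v : HeightOneSpectrum (𝓞 K)) (hv : ((ℓ : ℕ) : 𝓞 K) ∈ v.asIdeal),
                (Literature.NumberTheory.PAdicHodge.fontainePstAdicCompletion v ℓ hv).IsDeRhamFramed
                  (ρ.toLocal v)) ∧
            ∀ᶠ v : HeightOneSpectrum (𝓞 K) in cofinite, SatakeFrobCompatibleAt ι π.1 ρ v := by
  intro K _ _ n hcpt hn π hL ℓ _ ι
  -- (buildfix 2026-08-20, proof-only: the summit is now `Nonempty (ReciprocityData K) ∧ ∀ 𝓡, …`)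
  obtain ⟨⟨Rec⟩, hRec⟩ := h K
  obtain ⟨hA, -⟩ := hRec Rec n hn hcpt
  obtain ⟨ρ, -, hgeo, hcorr, -⟩ := hA π hL ℓ ι
  exact ⟨ρ, hgeo, hcorr.1⟩

/-! ### §3. The sector of W provable today: rank one, finite order, unramified above `ℓ` -/

/-- **Stub W in rank one for Hecke characters of finite order unramified above `ℓ`** (every number
field `K`; the pinned de Rham clause included).  Let `π` be a cuspidal automorphic representation of
`GL₁(𝔸_K)` (Borel–Jacquet datum) whose Hecke character `χ` (`r(g) φ - χ(det g) φ ∈ W'`,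
`AutomorphicRepData.exists_heckeCharacter_glOne`) has finite order and is unramified at every place
above `ℓ`, and let `ι : ℚ̄_ℓ ≃+* ℂ`.  Then there is a continuous `ρ : Γ_K → GL₁(ℚ̄_ℓ)` which is
unramified almost everywhere, de Rham at every `v ∣ ℓ` for Fontaine's pinned datum, and
Satake–Frobenius compatible with `(π, ι)` at all but finitely many places.  Proof: `ρ` is the
`ℓ`-adic avatar of the Artin character of `χ` (global class field theory, proved in the tree:
`HeckeCharacter.exists_lAdic_of_isFiniteOrder` — unramified at `v` iff `χ` is, with
`char(Frob_v) = X - ι⁻¹(χ(ϖ_v))⁻¹` there); at the (cofinitely many, Flath) places where `π` is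
unramified, `χ` is unramified with Satake parameter `{χ(ϖ_v)}` (`isUnramifiedAt_heckeCharacter_glOne`,
`exists_eq_singleton_of_hasSatakeParamAt_glOne`) and `arithFrobPolyOfSatake ι q_v 1 {χ(ϖ_v)} =
X - ι⁻¹(χ(ϖ_v))⁻¹`; above `ℓ`, `ρ` is unramified by hypothesis, hence de Rham for the pinned datum
(`isDeRhamFramed_fontainePstAdicCompletion_of_isUnramifiedAt`).  (Such `π` are automatically
L-algebraic; the hypothesis is not needed.)  Outside this sector — `χ` of infinite order or ramified
above `ℓ` — the de Rham clause is not dischargeable in the present tree (module docstring).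
[cite: CasselsFrohlichANT1967, Ch. VII §5.1 Main Theorem] [cite: SerreAbelianLadic1968, Ch. III §2.3]
[cite: BuzzardGeeLMS2014, Conj. 3.2.2 (case n = 1)] -/
theorem weakExistence_rankOne_of_isFiniteOrder (hcpt : isCompact_glFiniteIntegralLevel 1 K)
    (π : CuspidalAutomorphicRepData 1 K hcpt) {χ : HeckeCharacter K}
    (hχ : ∀ (g : (AdelicGroupData.gl 1 K).Adelic), ∀ φ ∈ π.1.W,
      rightTranslation (AdelicGroupData.gl 1 K) g φ -
        ((χ (Matrix.GeneralLinearGroup.det g) : ℂˣ) : ℂ) • φ ∈ π.1.W')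
    (hfin : χ.IsFiniteOrder)
    (hχℓ : ∀ v : HeightOneSpectrum (𝓞 K), ((ℓ : ℕ) : 𝓞 K) ∈ v.asIdeal → χ.IsUnramifiedAt v)
    (ι : PadicAlgCl ℓ ≃+* ℂ) :
    ∃ ρ : FramedGaloisRep K (PadicAlgCl ℓ) 1,
      ((∀ᶠ v : HeightOneSpectrum (𝓞 K) in cofinite, ρ.IsUnramifiedAt v) ∧
        ∀ (v : HeightOneSpectrum (𝓞 K)) (hv : ((ℓ : ℕ) : 𝓞 K) ∈ v.asIdeal),
          (Literature.NumberTheory.PAdicHodge.fontainePstAdicCompletion v ℓ hv).IsDeRhamFramed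
            (ρ.toLocal v)) ∧
      ∀ᶠ v : HeightOneSpectrum (𝓞 K) in cofinite, SatakeFrobCompatibleAt ι π.1 ρ v := by
  classical
  obtain ⟨r, hram, hfrob⟩ := χ.exists_lAdic_of_isFiniteOrder hfin ι
  have hunrπ : ∀ᶠ v : HeightOneSpectrum (𝓞 K) in cofinite, π.1.IsUnramifiedAt v :=
    π.1.hasSatakeParamAt_cofinite_holds
  have key : ∀ᶠ v : HeightOneSpectrum (𝓞 K) in cofinite, SatakeFrobCompatibleAt ι π.1 r v := by
    filter_upwards [hunrπ] with v hv
    obtain ⟨α, hα⟩ := hv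
    have hur : χ.IsUnramifiedAt v := π.1.isUnramifiedAt_heckeCharacter_glOne hχ hα
    refine ⟨α, hα, (hram v).2 hur, ?_⟩
    obtain ⟨ϖ, hϖ, rfl⟩ := π.1.exists_eq_singleton_of_hasSatakeParamAt_glOne hχ hα
    have hc : ((χ (localUnits v ϖ) : ℂˣ) : ℂ) = χ.valueAtUniformizer v := by
      rw [← HeckeCharacter.localComponent_eq_valueAtUniformizer hur hϖ,
        HeckeCharacter.localComponent_apply]
    rw [arithFrobPolyOfSatake_one, Multiset.map_singleton, Multiset.prod_singleton, hc]
    exact hfrob v hur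
  refine ⟨r, ⟨key.mono fun v ⟨_, _, h, _⟩ => h, fun v hv => ?_⟩, key⟩
  exact isDeRhamFramed_fontainePstAdicCompletion_of_isUnramifiedAt r v hv ((hram v).2 (hχℓ v hv))

/-- **Closed form of `weakExistence_rankOne_of_isFiniteOrder`** (all binders explicit, in the order
`K, ℓ, hcpt, π, χ`): the shape in which the sector can be registered as a sub-stub of the item
(`ledger workitem stub-add stmt-Langlands-14328 --name weakExistence_rankOne_of_isFiniteOrder_closed
--signature @work/stubs/WeakExistence.sig`) so that a `--supports` landing passes
`supports.stub-mismatch`. [cite: BuzzardGeeLMS2014, Conj. 3.2.2 (case n = 1)] -/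
theorem weakExistence_rankOne_of_isFiniteOrder_closed :
    ∀ (K : Type) [Field K] [NumberField K] (ℓ : ℕ) [Fact ℓ.Prime]
      (hcpt : isCompact_glFiniteIntegralLevel 1 K) (π : CuspidalAutomorphicRepData 1 K hcpt)
      (χ : HeckeCharacter K),
      (∀ (g : (AdelicGroupData.gl 1 K).Adelic), ∀ φ ∈ π.1.W,
        rightTranslation (AdelicGroupData.gl 1 K) g φ -
          ((χ (Matrix.GeneralLinearGroup.det g) : ℂˣ) : ℂ) • φ ∈ π.1.W') →
      χ.IsFiniteOrder →
      (∀ v : HeightOneSpectrum (𝓞 K), ((ℓ : ℕ) : 𝓞 K) ∈ v.asIdeal → χ.IsUnramifiedAt v) →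
      ∀ ι : PadicAlgCl ℓ ≃+* ℂ,
        ∃ ρ : FramedGaloisRep K (PadicAlgCl ℓ) 1,
          ((∀ᶠ v : HeightOneSpectrum (𝓞 K) in cofinite, ρ.IsUnramifiedAt v) ∧
            ∀ (v : HeightOneSpectrum (𝓞 K)) (hv : ((ℓ : ℕ) : 𝓞 K) ∈ v.asIdeal),
              (Literature.NumberTheory.PAdicHodge.fontainePstAdicCompletion v ℓ hv).IsDeRhamFramed
                (ρ.toLocal v)) ∧
          ∀ᶠ v : HeightOneSpectrum (𝓞 K) in cofinite, SatakeFrobCompatibleAt ι π.1 ρ v :=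
  fun _ _ _ _ _ hcpt π _ hχ hfin hχℓ ι =>
    weakExistence_rankOne_of_isFiniteOrder hcpt π hχ hfin hχℓ ι

end Summit.Langlands.Langlands.Theorems.ReciprocityUpToIrreducibility

end
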